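import Mathlib
import HarnessLib

/-!
# Route `UnitScaleTilt`, crux K1 «MinimiserStabilityRegPr» (stmt-QuantumFields-19200), route-R E′ S3 ∕ line «HKGK-ANALYTIC», row (R-loc) brick (2c) —
# THE ONE-DIMENSIONAL `C¹` BUMP PROFILE `g(r) = r²(s − r)²` ON `{0,…,s}` (`s = ℓ − 1`): its mass `Σ_r g = (s⁵ − s)∕30 ≥ ℓ⁵∕243` (`ℓ ≥ 3`), its odd second moment
# `Σ_r g·(2r − s)² = (s⁷ − 21s³ + 20s)∕210 ≥ ℓ⁷∕2048` (`ℓ ≥ 4`), the reflection `Σ_r g·(2r − s) = 0`, and uniform bounds on `g`, `g·(2r−s)` and their second differences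
# INCLUDING the boundary rows (`≤ 2ℓ²`, `≤ 18ℓ³`) — the numbers behind the blockwise inverse estimate (this seat's LOCATE-RLOC 7deca12a §2; ★w4-19200 g7 01:12:29Z «BRICK 2 GO»)

Cell `ym3-torus`, twin-width seat `ym-ust-19936-w8` (gen 5).  THEOREMS ONLY (0 `def`, 0 `sorry` — the profile is written out as the polynomial `r²(s−r)²` everywhere);
`--supports stmt-QuantumFields-19200 --as helper`, count-neutral.  YM₃ on T³ is a ladder rung (R3), not the Clay problem; nothing here claims S3, hKg-K, E′, the stub, the crux or the gap.

WHY.  The blockwise inverse estimate `Σ_B f² ≤ C_inv·ℓ⁻⁴·Σ_B u²` (for `Δu = f` on a `k`-block `B`, `f` affine in one block coordinate — ✓`Prop7FlatTransposeTent.transpose_blockSiteK`) pairs `f`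
with the interior bumps `Φ = Π_i g(r_i)` and `Φ·(2r_μ − s)`; the even pairing reads the mean of `f`, the odd one its slope; `Σ Φ·Δu = Σ (ΔΦ)·u` costs `‖ΔΦ‖₂`, and the `C¹` vanishing of
`g` at `r = 0, s` keeps the boundary rows of `ΔΦ` at the interior order `ℓ²·ℓ^{4(d−1)}` (with the `C⁰` profile `r(s−r)` half a power of `ℓ` is lost).  This file is the scalar arithmetic.

WHAT IS PROVED (ns `…Theorems.Prop7FlatBumpProfile`; `s : ℕ`, sums over `Finset.range (s+1)`, values in `ℝ`).
* §1 closed forms: `sum_profile_partial` ∕ ★ `sum_profile` (`Σ_{r≤s} r²(s−r)² = (s⁵ − s)∕30`), `sum_profile_odd_partial` ∕ ★ `sum_profile_sq_moment` (`Σ_{r≤s} r²(s−r)²(2r−s)² = (s⁷ − 21s³ + 20s)∕210`),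
  ★ `sum_profile_odd_moment_eq_zero` (`Σ_{r≤s} r²(s−r)²(2r − s) = 0`, reflection `r ↦ s − r`).
* §2 lower bounds: ★ `sum_profile_ge` (`ℓ ≥ 3 ⇒ Σ ≥ ℓ⁵∕243`, sharp at `ℓ = 3`), ★ `sum_profile_sq_moment_ge` (`ℓ ≥ 4 ⇒ Σ ≥ ℓ⁷∕2048`, sharp at `ℓ = 4`; at `ℓ = 3` the moment vanishes).
* §3 pointwise: `profile_nonneg`, `profile_le` (`g ≤ ℓ⁴∕16`), `abs_profile_odd_le` (`|g(2r−s)| ≤ ℓ⁵∕16`), `profile_zero`∕`profile_last` (`g(0) = g(s) = 0`),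
  ★ `abs_d2_profile_le` (interior `|2g(r) − g(r+1) − g(r−1)| ≤ 2ℓ²`, `1 ≤ r ≤ s−1`), `abs_bdry_profile_le` (`g(1) = g(s−1) ≤ ℓ²`),
  ★ `abs_d2_profile_odd_le` (interior `|2h(r) − h(r+1) − h(r−1)| ≤ 18ℓ³`, `h = g·(2r−s)`), `abs_bdry_profile_odd_le` (`|h(1)|, |h(s−1)| ≤ ℓ³`), `sq_two_mul_sub_le` (`(2r−s)² ≤ ℓ²`).
HONEST SCOPE.  High-school algebra (Faulhaber sums to degree 6, two polynomial positivity checks); nothing of Bałaban's is asserted.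

References: T. Bałaban, CMP 95 (1984) 17–40 [Balaban1984PropagatorsI] ((1.18) p.20, Sect. C p.22); M. Giaquinta, Princeton UP 1983 [Giaquinta1984] (Ch. III §2).
-/

set_option autoImplicit false

open scoped BigOperators

namespace Summit.QuantumFields.YangMills.Theorems.Prop7FlatBumpProfile

open Finset

/-! ## §1 Closed forms -/

/-- partial Faulhaber form of `Σ_{r≤m} r²(s−r)²`. [folklore] -/
theorem sum_profile_partial (s : ℕ) : ∀ m : ℕ,
    ∑ r ∈ Finset.range (m + 1), ((r : ℝ) ^ 2 * ((s : ℝ) - r) ^ 2)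
      = -(1/30 : ℝ) * m + (1/6 : ℝ) * m * (s : ℝ) ^ 2 - (1/2 : ℝ) * (m : ℝ) ^ 2 * s + (1/2 : ℝ) * (m : ℝ) ^ 2 * (s : ℝ) ^ 2
        + (1/3 : ℝ) * (m : ℝ) ^ 3 - (m : ℝ) ^ 3 * s + (1/3 : ℝ) * (m : ℝ) ^ 3 * (s : ℝ) ^ 2 + (1/2 : ℝ) * (m : ℝ) ^ 4 - (1/2 : ℝ) * (m : ℝ) ^ 4 * s
        + (1/5 : ℝ) * (m : ℝ) ^ 5
  | 0 => by simp
  | m + 1 => by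
    rw [Finset.sum_range_succ, sum_profile_partial s m]
    push_cast
    ring

/-- ★ `Σ_{r=0}^{s} r²(s−r)² = (s⁵ − s)∕30`. [folklore] -/
theorem sum_profile (s : ℕ) : ∑ r ∈ Finset.range (s + 1), ((r : ℝ) ^ 2 * ((s : ℝ) - r) ^ 2) = ((s : ℝ) ^ 5 - s) / 30 := by
  rw [sum_profile_partial s s]
  ring

/-- partial Faulhaber form of `Σ_{r≤m} r²(s−r)²(2r−s)²`. [folklore] -/
theorem sum_profile_odd_partial (s : ℕ) : ∀ m : ℕ,
    ∑ r ∈ Finset.range (m + 1), ((r : ℝ) ^ 2 * ((s : ℝ) - r) ^ 2 * (2 * (r : ℝ) - s) ^ 2)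
      = (2/21 : ℝ) * m - (13/30 : ℝ) * m * (s : ℝ) ^ 2 + (1/6 : ℝ) * m * (s : ℝ) ^ 4 + (m : ℝ) ^ 2 * s - (3/2 : ℝ) * (m : ℝ) ^ 2 * (s : ℝ) ^ 3
        + (1/2 : ℝ) * (m : ℝ) ^ 2 * (s : ℝ) ^ 4 - (2/3 : ℝ) * (m : ℝ) ^ 3 + (13/3 : ℝ) * (m : ℝ) ^ 3 * (s : ℝ) ^ 2 - 3 * (m : ℝ) ^ 3 * (s : ℝ) ^ 3
        + (1/3 : ℝ) * (m : ℝ) ^ 3 * (s : ℝ) ^ 4 - 5 * (m : ℝ) ^ 4 * s + (13/2 : ℝ) * (m : ℝ) ^ 4 * (s : ℝ) ^ 2 - (3/2 : ℝ) * (m : ℝ) ^ 4 * (s : ℝ) ^ 3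
        + 2 * (m : ℝ) ^ 5 - 6 * (m : ℝ) ^ 5 * s + (13/5 : ℝ) * (m : ℝ) ^ 5 * (s : ℝ) ^ 2 + 2 * (m : ℝ) ^ 6 - 2 * (m : ℝ) ^ 6 * s + (4/7 : ℝ) * (m : ℝ) ^ 7
  | 0 => by simp
  | m + 1 => by
    rw [Finset.sum_range_succ, sum_profile_odd_partial s m]
    push_cast
    ring

/-- ★ `Σ_{r=0}^{s} r²(s−r)²(2r−s)² = (s⁷ − 21s³ + 20s)∕210`. [folklore] -/
theorem sum_profile_sq_moment (s : ℕ) :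
    ∑ r ∈ Finset.range (s + 1), ((r : ℝ) ^ 2 * ((s : ℝ) - r) ^ 2 * (2 * (r : ℝ) - s) ^ 2) = ((s : ℝ) ^ 7 - 21 * (s : ℝ) ^ 3 + 20 * s) / 210 := by
  rw [sum_profile_odd_partial s s]
  ring

/-- ★ **REFLECTION**: `Σ_{r=0}^{s} r²(s−r)²(2r − s) = 0` (the summand is odd under `r ↦ s − r`). [folklore] -/
theorem sum_profile_odd_moment_eq_zero (s : ℕ) :
    ∑ r ∈ Finset.range (s + 1), ((r : ℝ) ^ 2 * ((s : ℝ) - r) ^ 2 * (2 * (r : ℝ) - s)) = 0 := by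
  have h := Finset.sum_range_reflect (fun r => ((r : ℝ) ^ 2 * ((s : ℝ) - r) ^ 2 * (2 * (r : ℝ) - s))) (s + 1)
  simp only [Nat.add_sub_cancel] at h
  have h' : ∑ r ∈ Finset.range (s + 1), (((s - r : ℕ) : ℝ) ^ 2 * ((s : ℝ) - ((s - r : ℕ) : ℝ)) ^ 2 * (2 * ((s - r : ℕ) : ℝ) - s))
      = -∑ r ∈ Finset.range (s + 1), ((r : ℝ) ^ 2 * ((s : ℝ) - r) ^ 2 * (2 * (r : ℝ) - s)) := by
    rw [← Finset.sum_neg_distrib]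
    refine Finset.sum_congr rfl fun r hr => ?_
    have hrs : r ≤ s := Nat.lt_succ_iff.mp (Finset.mem_range.mp hr)
    rw [Nat.cast_sub hrs]
    ring
  rw [h'] at h
  linarith

/-! ## §2 Lower bounds -/

/-- ★ **MASS OF THE PROFILE**: for `ℓ ≥ 3` and `s = ℓ − 1`, `Σ_{r<ℓ} r²(s−r)² ≥ ℓ⁵∕243` (equality at `ℓ = 3`). [folklore] -/
theorem sum_profile_ge {ℓ : ℕ} (hℓ : 3 ≤ ℓ) :
    (ℓ : ℝ) ^ 5 / 243 ≤ ∑ r ∈ Finset.range ℓ, ((r : ℝ) ^ 2 * (((ℓ - 1 : ℕ) : ℝ) - r) ^ 2) := by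
  obtain ⟨t, rfl⟩ := Nat.exists_eq_add_of_le hℓ
  have hs : 3 + t = (2 + t) + 1 := by ring
  rw [hs, show 2 + t + 1 - 1 = 2 + t from by omega, sum_profile (2 + t)]
  push_cast
  have ht : (0 : ℝ) ≤ t := Nat.cast_nonneg t
  nlinarith [pow_nonneg ht 2, pow_nonneg ht 3, pow_nonneg ht 4, pow_nonneg ht 5]

/-- ★ **SECOND MOMENT OF THE PROFILE**: for `ℓ ≥ 4` and `s = ℓ − 1`, `Σ_{r<ℓ} r²(s−r)²(2r−s)² ≥ ℓ⁷∕2048` (equality at `ℓ = 4`; the moment VANISHES at `ℓ = 3`). [folklore] -/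
theorem sum_profile_sq_moment_ge {ℓ : ℕ} (hℓ : 4 ≤ ℓ) :
    (ℓ : ℝ) ^ 7 / 2048 ≤ ∑ r ∈ Finset.range ℓ, ((r : ℝ) ^ 2 * (((ℓ - 1 : ℕ) : ℝ) - r) ^ 2 * (2 * (r : ℝ) - ((ℓ - 1 : ℕ) : ℝ)) ^ 2) := by
  obtain ⟨t, rfl⟩ := Nat.exists_eq_add_of_le hℓ
  have hs : 4 + t = (3 + t) + 1 := by ring
  rw [hs, show 3 + t + 1 - 1 = 3 + t from by omega, sum_profile_sq_moment (3 + t)]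
  push_cast
  have ht : (0 : ℝ) ≤ t := Nat.cast_nonneg t
  nlinarith [pow_nonneg ht 2, pow_nonneg ht 3, pow_nonneg ht 4, pow_nonneg ht 5, pow_nonneg ht 6, pow_nonneg ht 7]

/-! ## §3 Pointwise bounds (any `r ≤ s`, `s + 1 = ℓ`) -/

/-- `g ≥ 0`. [folklore] -/
theorem profile_nonneg (r s : ℝ) : 0 ≤ r ^ 2 * (s - r) ^ 2 := by positivity

/-- `g(r) ≤ ℓ⁴∕16` for `0 ≤ r ≤ s ≤ ℓ` (AM–GM `r(s−r) ≤ s²∕4`). [folklore] -/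
theorem profile_le {r s ℓ : ℝ} (hr : 0 ≤ r) (hrs : r ≤ s) (hsℓ : s ≤ ℓ) : r ^ 2 * (s - r) ^ 2 ≤ ℓ ^ 4 / 16 := by
  have h1 : r * (s - r) ≤ s ^ 2 / 4 := by nlinarith [sq_nonneg (2 * r - s)]
  have h2 : 0 ≤ r * (s - r) := mul_nonneg hr (by linarith)
  have h3 : s ^ 2 / 4 ≤ ℓ ^ 2 / 4 := by nlinarith
  calc r ^ 2 * (s - r) ^ 2 = (r * (s - r)) ^ 2 := by ring
    _ ≤ (ℓ ^ 2 / 4) ^ 2 := by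
        exact pow_le_pow_left₀ h2 (h1.trans h3) 2
    _ = ℓ ^ 4 / 16 := by ring

/-- `|g(r)(2r−s)| ≤ ℓ⁵∕16` for `0 ≤ r ≤ s`, `s + 1 ≤ ℓ`. [folklore] -/
theorem abs_profile_odd_le {r s ℓ : ℝ} (hr : 0 ≤ r) (hrs : r ≤ s) (hsℓ : s + 1 ≤ ℓ) :
    |r ^ 2 * (s - r) ^ 2 * (2 * r - s)| ≤ ℓ ^ 5 / 16 := by
  have hg := profile_le hr hrs (by linarith : s ≤ ℓ)
  have hq : |2 * r - s| ≤ ℓ := by rw [abs_le]; constructor <;> linarith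
  rw [abs_mul, abs_of_nonneg (profile_nonneg r s)]
  have hℓ : 0 ≤ ℓ := by linarith
  calc r ^ 2 * (s - r) ^ 2 * |2 * r - s| ≤ ℓ ^ 4 / 16 * ℓ := mul_le_mul hg hq (abs_nonneg _) (by positivity)
    _ = ℓ ^ 5 / 16 := by ring

/-- `g(0) = 0`. [folklore] -/
theorem profile_zero (s : ℝ) : (0 : ℝ) ^ 2 * (s - 0) ^ 2 = 0 := by ring

/-- `g(s) = 0`. [folklore] -/
theorem profile_last (s : ℝ) : s ^ 2 * (s - s) ^ 2 = 0 := by ring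

/-- ★ **INTERIOR SECOND DIFFERENCE**: `|2g(r) − g(r+1) − g(r−1)| ≤ 2ℓ²` for `0 ≤ r ≤ s`, `s + 1 ≤ ℓ` (`= |12r² − 12rs + 2s² + 2|`). [folklore] -/
theorem abs_d2_profile_le {r s ℓ : ℝ} (hr : 0 ≤ r) (hrs : r ≤ s) (hsℓ : s + 1 ≤ ℓ) :
    |2 * (r ^ 2 * (s - r) ^ 2) - (r + 1) ^ 2 * (s - (r + 1)) ^ 2 - (r - 1) ^ 2 * (s - (r - 1)) ^ 2| ≤ 2 * ℓ ^ 2 := by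
  have e : 2 * (r ^ 2 * (s - r) ^ 2) - (r + 1) ^ 2 * (s - (r + 1)) ^ 2 - (r - 1) ^ 2 * (s - (r - 1)) ^ 2
      = -(12 * r ^ 2 - 12 * r * s + 2 * s ^ 2 + 2) := by ring
  rw [e, abs_neg, abs_le]
  have h1 : r * (s - r) ≥ 0 := mul_nonneg hr (by linarith)
  have h2 : r * (s - r) ≤ s ^ 2 / 4 := by nlinarith [sq_nonneg (2 * r - s)]
  have hs0 : 0 ≤ s := hr.trans hrs
  constructor <;> nlinarith

/-- **BOUNDARY ROW**: `g(1) = (s−1)² ≤ ℓ²` (the only neighbour value entering `ΔΦ` at `r = 0`; likewise `g(s−1)` at `r = s`). [folklore] -/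
theorem abs_bdry_profile_le {s ℓ : ℝ} (hs : 0 ≤ s) (hsℓ : s + 1 ≤ ℓ) : (1 : ℝ) ^ 2 * (s - 1) ^ 2 ≤ ℓ ^ 2 := by
  nlinarith [sq_nonneg (s - 1)]

/-- the mirrored boundary value `g(s−1) = (s−1)²`. [folklore] -/
theorem profile_sub_one (s : ℝ) : (s - 1) ^ 2 * (s - (s - 1)) ^ 2 = (1 : ℝ) ^ 2 * (s - 1) ^ 2 := by ring

/-- ★ **INTERIOR SECOND DIFFERENCE OF THE ODD PROFILE** `h(r) = g(r)(2r−s)`: `|2h(r) − h(r+1) − h(r−1)| ≤ 18ℓ³` for `0 ≤ r ≤ s`, `s + 1 ≤ ℓ`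
(`= |(2r−s)(5(2r−s)² − 3s² + 10)|`). [folklore] -/
theorem abs_d2_profile_odd_le {r s ℓ : ℝ} (hr : 0 ≤ r) (hrs : r ≤ s) (hsℓ : s + 1 ≤ ℓ) :
    |2 * (r ^ 2 * (s - r) ^ 2 * (2 * r - s)) - (r + 1) ^ 2 * (s - (r + 1)) ^ 2 * (2 * (r + 1) - s)
        - (r - 1) ^ 2 * (s - (r - 1)) ^ 2 * (2 * (r - 1) - s)| ≤ 18 * ℓ ^ 3 := by
  have e : 2 * (r ^ 2 * (s - r) ^ 2 * (2 * r - s)) - (r + 1) ^ 2 * (s - (r + 1)) ^ 2 * (2 * (r + 1) - s)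
        - (r - 1) ^ 2 * (s - (r - 1)) ^ 2 * (2 * (r - 1) - s)
      = -((2 * r - s) * (5 * (2 * r - s) ^ 2 - 3 * s ^ 2 + 10)) := by ring
  rw [e, abs_neg, abs_mul]
  have hq : |2 * r - s| ≤ ℓ := by rw [abs_le]; constructor <;> linarith
  have hq2 : (2 * r - s) ^ 2 ≤ s ^ 2 := by nlinarith
  have hs0 : 0 ≤ s := hr.trans hrs
  have hℓ1 : 1 ≤ ℓ := by linarith
  have hin : |5 * (2 * r - s) ^ 2 - 3 * s ^ 2 + 10| ≤ 18 * ℓ ^ 2 := by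
    rw [abs_le]; constructor <;> nlinarith
  calc |2 * r - s| * |5 * (2 * r - s) ^ 2 - 3 * s ^ 2 + 10| ≤ ℓ * (18 * ℓ ^ 2) :=
        mul_le_mul hq hin (abs_nonneg _) (by linarith)
    _ = 18 * ℓ ^ 3 := by ring

/-- **BOUNDARY ROW OF THE ODD PROFILE**: `|h(1)| = (s−1)²|2 − s| ≤ ℓ³`. [folklore] -/
theorem abs_bdry_profile_odd_le {s ℓ : ℝ} (hs : 1 ≤ s) (hsℓ : s + 1 ≤ ℓ) : |(1 : ℝ) ^ 2 * (s - 1) ^ 2 * (2 * 1 - s)| ≤ ℓ ^ 3 := by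
  rw [abs_le]
  have h1 : (s - 1) ^ 2 ≤ ℓ ^ 2 := by nlinarith
  have h2 : |2 * 1 - s| ≤ ℓ := by rw [abs_le]; constructor <;> linarith
  have h3 : |(1 : ℝ) ^ 2 * (s - 1) ^ 2 * (2 * 1 - s)| ≤ ℓ ^ 3 := by
    rw [abs_mul, abs_of_nonneg (by positivity : (0 : ℝ) ≤ 1 ^ 2 * (s - 1) ^ 2)]
    calc 1 ^ 2 * (s - 1) ^ 2 * |2 * 1 - s| ≤ ℓ ^ 2 * ℓ := mul_le_mul (by linarith) h2 (abs_nonneg _) (by positivity)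
      _ = ℓ ^ 3 := by ring
  exact abs_le.mp h3

/-- the mirrored boundary value `h(s−1) = −h(1)`. [folklore] -/
theorem profile_odd_sub_one (s : ℝ) :
    (s - 1) ^ 2 * (s - (s - 1)) ^ 2 * (2 * (s - 1) - s) = -((1 : ℝ) ^ 2 * (s - 1) ^ 2 * (2 * 1 - s)) := by ring

/-- `(2r − s)² ≤ ℓ²` for `0 ≤ r ≤ s`, `s + 1 ≤ ℓ`. [folklore] -/
theorem sq_two_mul_sub_le {r s ℓ : ℝ} (hr : 0 ≤ r) (hrs : r ≤ s) (hsℓ : s + 1 ≤ ℓ) : (2 * r - s) ^ 2 ≤ ℓ ^ 2 := by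
  nlinarith

end Summit.QuantumFields.YangMills.Theorems.Prop7FlatBumpProfile
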